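import Summits.HodgeConjecture.HodgeConjecture.Theorems.DworkReflectionQuotientsGIOfFrames
import Literature.AlgebraicGeometry.HodgeTheory.DworkSexticPencilResidueClimb

/-!
# Route `DworkReflectionQuotients`: crux `GenericInvariantHodgeClasses` (GI) modulo the two PRIMARY analytic
# facts of the Dwork pencil — Griffiths' holomorphic Hodge frames (Voisin I Thm. 10.3) and the
# Carlson–Griffiths residues with their derivative (Voisin II Cor. 6.12, Thm. 6.10, 6.13, Cor. 5.17)

Route `route-HodgeConjecture-DworkReflectionQuotients` (cell `hodge-nonav`; FRONTIER rung F-H1 — never summit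
credit), item `stmt-HodgeConjecture-24129` `GenericInvariantHodgeClasses`. Prover seat `hodge-nonav-20241-p1`
(g9). SUPPORT FILE (`--supports`; CONDITIONAL results). Both analytic inputs `hol` / `climb` of
`genericInvariantHodgeClasses_of_facts` are now TREE THEOREMS modulo primary, print-verbatim named facts:
`hol` from `DworkSextic.Griffiths1968_dworkPencil_holomorphicHodgeFrames` (file `DworkSexticPencilHolomorphicFrames`)
and `climb` from `DworkSextic.Voisin2003_dworkPencil_residues_infinitesimal` (file `DworkSexticPencilResidueClimb`,
where the tree's invariant theory of the Jacobian ring — `prod_X_mul_mem_jacobianIdeal_iff`, the Reynolds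
operator `sum_gammaW_aeval_diagSubst` — is load-bearing). Hence the item's signature, the support
`GenericHodgeClassesFlat` and the rung leaf `DworkSexticHodge` follow from {frames, residues} (+ crux K1 for the
last two). Residual print dependence of the route: {Bini–Garbagnati 3.20 + KMM (K1's fact), Voisin I Thm. 10.3
along the pencil, Voisin II §6.1–6.2 residues/IVHS along the pencil}. Nothing here says HC, HC_CM or HC_AV is
proved; rung F-H1 not moved.

## References

* C. Voisin, *Hodge Theory and Complex Algebraic Geometry I* (2002), Thm. 10.3. [VoisinHodgeI2002]
* C. Voisin, *Hodge Theory and Complex Algebraic Geometry II* (2003), §5.3, §6.1–§6.2, Thm. 6.24 (proof).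
  [VoisinHodgeII2003]
-/

namespace Summit.HodgeConjecture.HodgeConjecture.Theorems

open Literature.AlgebraicGeometry.HodgeTheory

/-- **`GenericInvariantHodgeClasses` (stmt-HodgeConjecture-24129), signature verbatim, from the two primary
analytic facts** (holomorphic Hodge frames; Carlson–Griffiths residues along the pencil). CONDITIONAL; rung
F-H1 not moved. [cite: VoisinHodgeI2002, Thm. 10.3] [cite: VoisinHodgeII2003, Thm. 6.13 and Thm. 6.24 (proof)] -/
theorem genericInvariantHodgeClasses_of_frames_of_residues
    (hframes : DworkSextic.Griffiths1968_dworkPencil_holomorphicHodgeFrames)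
    (hres : DworkSextic.Voisin2003_dworkPencil_residues_infinitesimal) :
    ∃ S : Set ℂ, S.Countable ∧ ∀ ψ : ℂ, ψ ∉ S → ψ ^ 6 ≠ 1 → let F : MvPolynomial (Fin 6) ℂ := (∑ i, MvPolynomial.X i ^ 6) - MvPolynomial.C (6 * ψ) * ∏ i, MvPolynomial.X i; let X := Literature.AlgebraicGeometry.Motives.SmoothHypersurface.hypersurface F; let pt := Literature.AlgebraicGeometry.HodgeTheory.hypersurfacePoint (Literature.AlgebraicGeometry.Motives.SmoothHypersurface.hypersurfaceι F); ∀ c : Literature.AlgebraicGeometry.HodgeTheory.complexBetti X (2 * 2), Literature.AlgebraicGeometry.HodgeTheory.IsRationalClass c → Literature.AlgebraicGeometry.HodgeTheory.IsOfHodgeType 4 X (2 * 2) 2 2 c → (∀ a : Fin 6 → ℂ, (∀ i, a i ^ 6 = 1) → ∏ i, a i = 1 → ∀ g : C(Literature.AlgebraicGeometry.Motives.ComplexPoints X, Literature.AlgebraicGeometry.Motives.ComplexPoints X), (∀ x, ∃ t : ℂ, (pt (g x)).rep = t • (a * (pt x).rep)) → Literature.AlgebraicTopology.SingularHomology.singularCohomology.map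 ℂ ℂ g (2 * 2) c = c) → c ∈ Literature.AlgebraicGeometry.HodgeTheory.algebraicClasses X 2 :=
  genericInvariantHodgeClasses_of_frames_of_climb hframes
    (DworkSextic.Voisin2003_dworkPencil_invariantFlatSection_climb_of_residues hres)

/-- **The rung leaf `DworkSexticHodge` BY NAME from crux K1 and the two primary analytic facts.**
CONDITIONAL (K1 open — in tree modulo the Bini–Garbagnati fact); FRONTIER rung F-H1, never summit credit.
[cite: VoisinHodgeI2002, Thm. 10.3] [cite: VoisinHodgeII2003, Thm. 6.13 and Thm. 6.24 (proof)] -/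
theorem dworkSexticHodge_of_reflectionQuotientDescent_of_frames_of_residues
    (h1 : Summit.HodgeConjecture.HodgeConjecture.Theses.DworkReflectionQuotients.ReflectionQuotientDescent)
    (hframes : DworkSextic.Griffiths1968_dworkPencil_holomorphicHodgeFrames)
    (hres : DworkSextic.Voisin2003_dworkPencil_residues_infinitesimal) :
    Summit.HodgeConjecture.HodgeConjecture.Theses.DworkPrymHodge.DworkSexticHodge :=
  dworkSexticHodge_of_reflectionQuotientDescent_of_frames_of_climb h1 hframes
    (DworkSextic.Voisin2003_dworkPencil_invariantFlatSection_climb_of_residues hres)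

/-- **The support `GenericHodgeClassesFlat` (stmt-HodgeConjecture-20243) BY NAME from crux K1 and the two
primary analytic facts.** CONDITIONAL; rung F-H1 not moved.
[cite: VoisinHodgeI2002, Thm. 10.3] [cite: VoisinHodgeII2003, Thm. 6.13 and Thm. 6.24 (proof)] -/
theorem genericHodgeClassesFlat_of_reflectionQuotientDescent_of_frames_of_residues
    (h1 : Summit.HodgeConjecture.HodgeConjecture.Theses.DworkReflectionQuotients.ReflectionQuotientDescent)
    (hframes : DworkSextic.Griffiths1968_dworkPencil_holomorphicHodgeFrames)
    (hres : DworkSextic.Voisin2003_dworkPencil_residues_infinitesimal) :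
    Summit.HodgeConjecture.HodgeConjecture.Theses.DworkReflectionQuotients.GenericHodgeClassesFlat :=
  genericHodgeClassesFlat_of_reflectionQuotientDescent_of_frames_of_climb h1 hframes
    (DworkSextic.Voisin2003_dworkPencil_invariantFlatSection_climb_of_residues hres)

end Summit.HodgeConjecture.HodgeConjecture.Theorems
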